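import Literature.AlgebraicGeometry.Frobenioids.FrobenioidRealificationCanonical
import Literature.AlgebraicGeometry.Frobenioids.RealificationNatTrans
import Literature.AlgebraicGeometry.Frobenioids.ModelFrobenioidStandard
import Literature.AlgebraicGeometry.Frobenioids.ModelFrobenioidIsFrobenioid
import Literature.AlgebraicGeometry.Frobenioids.DivisorMonoidCategoryTheoreticity
import HarnessLib

/-!
# Frobenioids I, §5: Proposition 5.3 (Realifications) + Corollary 5.4 (Category-theoreticity of the
# Realification) — SUB-DAG statements over THE realification `C^rlf` (cell sub-DAG W3, L1-lead R81)

Mochizuki, *The geometry of Frobenioids I: the general theory*, Kyushu J. Math. **62** (2008) 293–400,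
§5, Proposition 5.3, kurims p. 103 ll. 9–36, and Corollary 5.4, kurims p. 103 l. 37 – p. 104 l. 24
[cite: MochizukiFrdI2008, Prop. 5.3 p.103] [cite: MochizukiFrdI2008, Cor. 5.4 p.103].

**Text (p. 103 ll. 9–16).** "Suppose that `Φ` is perf-factorial. Then we shall refer to as the realification
`C^rlf` of the Frobenioid `C` the model Frobenioid [cf. Theorem 5.2, (ii)] associated to the divisor monoid
`Φ^rlf` [i.e., the 'realification' of Definition 2.4, (i)] and the rational function monoid
`ℝ · Φ^birat ⊆ (Φ^rlf)^gp` [i.e., for `A_D ∈ Ob(D)`, `(ℝ · Φ^birat)(A_D)` is the `ℝ`-vector subspace of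
`(Φ^rlf)^gp(A_D)` generated by `Φ^birat(A_D)`]."  (p. 104 ll. 1–9) "there exists a 1-unique functor
`Ψ^rlf : C₁^rlf → C₂^rlf` that fits into a 1-commutative diagram […] [where the vertical arrows are the natural
functors of Proposition 5.3; the horizontal arrows are equivalences of categories]. Moreover, each of the
composite functors of this diagram is rigid. Finally, the formation of `Ψ^rlf` from `Ψ` is 1-compatible with
the 1-commutative diagram of Proposition 5.3 [involving perfections, unit-trivializations, etc.]."
(Proof, p. 104 ll. 21–24) "In light of the definition of the realification [cf. Proposition 5.3], Corollary
5.4 follows immediately from Corollaries 4.10; 4.11, (iii), (iv)."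

**What this file is (cell abc-iut, L1 sub-DAG W3 = plan/L1/DISCHARGE-L1.md §0 row W3; L1-lead R81 (1)).**
The typed statements of record are the SCHEMAS `PreFrobenioid.Prop53_untr / Prop53_untrPf / Prop53_diagram /
Cor54` (`FrobenioidRealification.lean`, seat abc-iut-L1-t5) over interface parameters; THE constructions are
landed (seat abc-iut-L1-d2: `RealificationData.canonical`, `PreFrobenioid.rlf F hΦ` = THE `C^rlf` with structure
functor `rlfToElem`, the row `C^un-tr → (C^un-tr)^pf → C^rlf` in the model description, `f^rlf =
IsPerfFactorial.Rlf.map`, `η^rlf`, `rlfModelMap`).  This file cuts the PRINTED PROOFS into intermediate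
STATEMENTS over those landed declarations (markdown table `SUBDAG-FrdI-Prop53-Cor54.md`, rows P53/L02a–L05c,
C54/L02–L09):

* Prop. 5.3 calls `Φ^rlf` "the divisor monoid `Φ^rlf`" and `ℝ · Φ^birat` "the rational function monoid" and
  invokes Thm. 5.2 (ii); i.e. the data `(Φ^rlf, ℝ · Φ^birat)` are implicitly asserted to satisfy the hypotheses
  of Thm. 5.2 (`ModelFrobenioid.Hypotheses`, file `ModelFrobenioidStandard.lean`): rows `IsMonoidOnRlf`
  (`Φ^rlf` is a monoid ON `D` — Def. 2.4 (i) p. 48 is objectwise only: "one verifies immediately that `M^pf`,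
  `M^rlf` are also perf-factorial"), `RlfDivisorial`, `GpSubfunctor.IsFSMSurjective` / `IsMonoidOnRealSpan`,
  and the package `RlfHypotheses` = `ModelFrobenioid.Hypotheses (Φ^rlf) (ℝ · Φ^birat)` asked for BY NAME by
  the Prop. 5.5 sub-DAG (`Prop55Sub.lean` header (a), seats abc-iut-w4-d084 / w5-d169), with the composition
  `rlf_isFrobenioid_of_hypotheses` = Thm. 5.2 (ii) (`ModelFrobenioid.isFrobenioid`, seat abc-iut-found) at
  THE realified data: **THE `C^rlf` IS a Frobenioid, of isotropic type** — closing the named hypothesis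
  `IsFrobenioid (rlfToElem F hΦ)` of `Prop55Sub` once the rows land.  **FINDING P53-F1 (seat abc-iut-L1-d2,
  cell INBOX 2026-08-26T00:36:52Z; kernel witness in that seat's `RealificationMapNotInjective.lean`):** the
  UNIVERSAL form "`Φ` a monoid on `D` ⇒ `Φ^rlf` a monoid on `D`" is FALSE — `f : ℕ² → ℝ_{≥0}`,
  `(a, b) ↦ a + b√2` is characteristically injective while `f^rlf : ℝ_{≥0}² → ℝ_{≥0}` is not injective; print's
  "the divisor monoid `Φ^rlf`" silently uses that in the motivating examples the pull-backs of `Φ` pull divisors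
  back prime by prime.  Accordingly `IsMonoidOnRlf` carries the hypothesis `PullbacksReflectDvd Φ` (the
  pull-back maps REFLECT divisibility — true for every divisor monoid of the cell; under it `f^rlf` is injective
  by the order-reflection argument of [EtTh] Lem. 3.5 (i), `RlfUniversal.lift_injective`), and the
  monoid-level rows are `RlfMapInjectiveOfReflects` (divisibility reflection — the row the (H)-chain uses) and
  `RlfMapInjective'` (L1-lead R89 (r2): disjoint supports of the images of distinct primes; RETIRED AS TYPED by
  finding P53-F2, seat abc-iut-w4-d084 — see its docstring); NO universal row is a discharge target;
* `iotaRlf` — THE natural functor `C^istr → C^rlf` of Prop. 5.3 (the composite of the diagram), parametrised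
  by the comparison equivalence `C^un-tr ≌ (model of (Φ, Φ^birat))` of `Prop53_untr` (Thm. 5.2 (iv) at
  `C^un-tr`, seat abc-iut-L6-t8) — the vertical arrows of Cor. 5.4;
* Cor. 5.4 in OPERATIONS FORM over the DATA of Cor. 4.11 (iii)/(iv) (`PreFrobenioidData.DivisorMonoidIsoOverBase`,
  `Cor411iv`, seat abc-iut-L1-t3) taken as BINDERS: `RlfMonoidIso` (Ψ^Φ realifies), `BiratCompat`,
  `RealSpanCompat`, `RlfTransport` (the model-level `Ψ^rlf`, base-changing analogue of d2's `rlfModelMap`),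
  `Square`, `OneUniqueData` (honest form of 1-uniqueness, see its docstring), `Rigid`, `CompatProp53`
  (the final clause, recorded-not-typed in `FrobenioidRealification.lean`, typed here over named binders).

Every NEW name is a `def … : Prop` statement (or the data `iotaRlf`), NOT asserted; Cor. 4.10/4.11, Thm. 3.4,
Prop. 5.5 enter only as binders by their typed names (no new `Prop` FACT).  Slots `…_holds` are for the
provers (proof-only companions `Prop53SubProofs*.lean`).  No statement of the paper is strengthened; where a
row is weaker or differently quantified than print this is said in its docstring.  Nothing here bears on
[IUTchIII] Cor. 3.12 (L1 = [FrdI], a refereed preparatory paper).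
-/

noncomputable section

namespace Literature.AlgebraicGeometry.Frobenioids

open CategoryTheory Opposite Literature.AnabelianGeometry.EtaleTheta

universe w v v' u u' v₁ v₁' u₁ u₁' v₂ v₂' u₂ u₂'

/-! ### A subfunctor of groups whose pull-backs along FSM-morphisms are surjective -/

namespace GpSubfunctor

variable {D : Type u} [Category.{v} D] {Φ : Dᵒᵖ ⥤ CommMonCat.{w}} (Ψ : GpSubfunctor Φ)

/-- For a subfunctor of groups `Ψ ⊆ Φ^gp`: the pull-back `Ψ(Y) → Ψ(X)` along every FSM-morphism `f : X → Y`
of `D` is SURJECTIVE — the half of "`Ψ` is a [group-like] monoid on `D`" (Def. 1.1 (ii) (b): "`α^*` is an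
isomorphism whenever `α` is an FSM-morphism") that is not automatic for a subfunctor (injectivity is inherited
from `Φ^gp`).  Thm. 5.2 (p. 100) asks the rational function monoid `B` to be "a group-like monoid on `D`".
[cite: MochizukiFrdI2008, Thm. 5.2 p.100] -/
def IsFSMSurjective : Prop :=
  ∀ ⦃X Y : D⦄ (f : X ⟶ Y), IsFSM f →
    ∀ c ∈ Ψ.carrier X, ∃ c' ∈ Ψ.carrier Y, pullGp Φ f c' = c

end GpSubfunctor

namespace FrdI.Prop53Sub

variable {D : Type u} [Category.{v} D] {Φ : Dᵒᵖ ⥤ CommMonCat.{w}}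
  {C : Type u'} [Category.{v'} C] (F : C ⥤ ElemFrobenioid Φ)

/-! ### Proposition 5.3: "the divisor monoid `Φ^rlf`" and "the rational function monoid `ℝ · Φ^birat`" -/

variable (Φ) in
/-- The pull-back maps of `Φ` REFLECT divisibility: `Φ(α)(a) ≤ Φ(α)(b) ⇒ a ≤ b` — true for the divisor monoids of
the motivating examples (geometric / arithmetic / tempered divisors pull back prime by prime with positive
multiplicities), and the hypothesis under which the realified pull-backs are injective (finding P53-F1: NOT
implied by "`Φ` is a monoid on `D`" alone). A hypothesis/vocabulary predicate, not a fact.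
[cite: MochizukiFrdI2008, Prop. 5.3 p.103] -/
def PullbacksReflectDvd : Prop :=
  ∀ ⦃A B : D⦄ (α : B ⟶ A) (a b : Φ.obj (op A)), pull Φ α a ∣ pull Φ α b → a ∣ b

variable (Φ) in
/-- **P53/L02a** (implicit in Prop. 5.3 p. 103 l. 12, "the divisor monoid `Φ^rlf`"): for a perf-factorial MONOID
`Φ` ON `D` (Def. 1.1 (ii)) whose pull-backs reflect divisibility (`PullbacksReflectDvd`; see P53-F1 in the
module docstring — the unguarded implication is false), the realification `Φ^rlf = rlfFunctor Φ hΦ` is again a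
monoid on `D` (pull-backs characteristically injective; isomorphisms along FSM-morphisms).  Since `M^rlf` is
sharp (`IsPerfFactorial.Rlf.isSharp`), this is the INJECTIVITY of `f^rlf = IsPerfFactorial.Rlf.map`
(`RlfMapInjectiveOfReflects`) plus functoriality (`Rlf.map_id'`, `map_comp'`).
[cite: MochizukiFrdI2008, Prop. 5.3 p.103] -/
def IsMonoidOnRlf (hΦ : ∀ X : Dᵒᵖ, IsPerfFactorial (Φ.obj X)) : Prop :=
  IsMonoidOn Φ → PullbacksReflectDvd Φ → IsMonoidOn (rlfFunctor Φ hΦ)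

/-- **P53/L02a, monoid-theoretic core (divisibility-reflection form)**: for perf-factorial monoids `M`, `N` and
an injective homomorphism `f : M → N` that REFLECTS divisibility, the induced `f^rlf : M^rlf → N^rlf`
(universal property of the realification, Def. 2.4 (i)) is injective.  (The form with `f` merely
characteristically injective is FALSE — P53-F1, `(a, b) ↦ a + b√2`.) [cite: MochizukiFrdI2008, Def. 2.4 (i) p.48] -/
def RlfMapInjectiveOfReflects : Prop :=
  ∀ ⦃M N : Type w⦄ [CommMonoid M] [CommMonoid N] (hM : IsPerfFactorial M) (hN : IsPerfFactorial N)
    (f : M →* N), Function.Injective f → (∀ a b : M, f a ∣ f b → a ∣ b) →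
      Function.Injective (IsPerfFactorial.Rlf.map hM hN f)

/-- **P53/L02a′, monoid-theoretic core (disjoint-supports form, L1-lead R89 (r2), seat abc-iut-L1-d2's shape)**:
for perf-factorial `M`, `N` and a characteristically injective `f : M → N` such that the images under `f^pf` of
primary elements of DISTINCT primes of `M^pf` have DISJOINT supports in `N^rlf_factor` (prime-by-prime pull-back,
as in the motivating examples), `f^rlf` is injective.  **RETIRED AS TYPED (finding P53-F2, seat abc-iut-w4-d084):**
TRUE — and then it implies divisibility reflection — when every element of `M^pf` has FINITE support (the divisor
monoids of the paper; `IsPerfFactorial.Rlf.map_injective_of_disjoint_supp_of_finite`), but over `∏_{A ⊔ A} ℚ_{≥0}`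
its negation follows from a countably complete non-principal ultrafilter on `A`
(`P53F2.not_rlfMapInjective'_of_countableInter_ultrafilter`).  No consumer; statement unchanged (frozen).
[cite: MochizukiFrdI2008, Def. 2.4 (i) p.48] -/
def RlfMapInjective' : Prop :=
  ∀ ⦃M N : Type w⦄ [CommMonoid M] [CommMonoid N] (hM : IsPerfFactorial M) (hN : IsPerfFactorial N)
    (f : M →* N), IsCharInjective f →
      (∀ (𝔭 𝔮 : Primes (Perfection M)), 𝔭 ≠ 𝔮 → ∀ x ∈ 𝔭.carrier, ∀ y ∈ 𝔮.carrier,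
        Disjoint (supp (hN.toRealification (Perfection.map f x) : RlfFactor N))
          (supp (hN.toRealification (Perfection.map f y) : RlfFactor N))) →
      Function.Injective (IsPerfFactorial.Rlf.map hM hN f)

variable (Φ) in
/-- **P53/L02b**: `Φ^rlf` is (objectwise) divisorial — Def. 2.4 (i) (a) for `M^rlf` ("`M^rlf` [is] also
perf-factorial", p. 48; tree: `IsPerfFactorial.Rlf.isDivisorial`). [cite: MochizukiFrdI2008, Def. 2.4 (i) p.48] -/
def RlfDivisorial (hΦ : ∀ X : Dᵒᵖ, IsPerfFactorial (Φ.obj X)) : Prop :=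
  Objectwise (fun M _ => IsDivisorial M) (rlfFunctor Φ hΦ)

/-- **P53/L02c**: for ANY realification datum `R` and subfunctor of groups `Ψ ⊆ Φ^gp` with FSM-surjective
pull-backs, the `ℝ`-span `ℝ · Ψ ⊆ (Φ^rlf)^gp` ("the rational function monoid `ℝ · Φ^birat`", p. 103 l. 13)
is a monoid on `D`, granted that `Φ^rlf` is an (integral) monoid on `D` (injectivity of the pull-backs of
`(Φ^rlf)^gp`; surjectivity along FSM-morphisms from that of `Ψ` and `ℝ`-linearity `pullGp_rsmul`).
[cite: MochizukiFrdI2008, Prop. 5.3 p.103] -/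
def IsMonoidOnRealSpan (R : RealificationData Φ) (Ψ : GpSubfunctor Φ) : Prop :=
  IsMonoidOn R.rlf → Objectwise (fun M _ => IsIntegral M) R.rlf → Ψ.IsFSMSurjective →
    IsMonoidOn (R.realSpan Ψ).toMonoid

/-- **P53/L02c'**: the `ℝ`-span `ℝ · Ψ` is (objectwise) GROUP-LIKE (it is a subgroup of `(Φ^rlf)^gp`; Thm. 5.2
p. 100 "`B` a group-like monoid"). [cite: MochizukiFrdI2008, Thm. 5.2 p.100] -/
def RealSpanGroupLike (R : RealificationData Φ) (Ψ : GpSubfunctor Φ) : Prop :=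
  Objectwise (fun M _ => IsGroupLike M) (R.realSpan Ψ).toMonoid

/-- **P53/L02d** (INPUT-shaped row): the rational-function subfunctor `Φ^birat = biratSubfunctor F`
(Prop. 4.4 (iii)) has surjective pull-backs along FSM-morphisms — the content of "`Φ^birat` is a group-like
monoid on `D`" used when Prop. 5.3 feeds `(Φ, Φ^birat)` / `(Φ^rlf, ℝ · Φ^birat)` to Thm. 5.2 (ii).
[cite: MochizukiFrdI2008, Prop. 5.3 p.103] -/
def BiratFSMSurjective : Prop :=
  (PreFrobenioid.biratSubfunctor F).IsFSMSurjective

/-- **P53/L02 = row (H)** (L1-lead R81 (1); named BY the Prop. 5.5 sub-DAG): the data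
`(Φ^rlf, ℝ · Φ^birat ↪ (Φ^rlf)^gp)` of THE realification satisfy the hypotheses of Thm. 5.2 — `Φ^rlf` a
divisorial monoid on `D`, `ℝ · Φ^birat` a group-like monoid on `D`, `D` connected and totally epimorphic —
i.e. Prop. 5.3's "the model Frobenioid [cf. Theorem 5.2, (ii)] associated to the divisor monoid `Φ^rlf` … and
the rational function monoid `ℝ · Φ^birat`" is licensed. [cite: MochizukiFrdI2008, Prop. 5.3 p.103] -/
def RlfHypotheses (hΦ : PreFrobenioid.IsPerfFactorialOn Φ) : Prop :=
  ModelFrobenioid.Hypotheses (rlfFunctor Φ (PreFrobenioid.IsPerfFactorialOn.op hΦ))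
    ((RealificationData.canonical Φ (PreFrobenioid.IsPerfFactorialOn.op hΦ)).realSpan
      (PreFrobenioid.biratSubfunctor F)).toMonoid

/-- **Composition (H) ⟸ rows**, PROVED (pure logic over the named rows): `Φ` a monoid on `D` whose pull-backs
reflect divisibility, `D` connected and totally epimorphic, and the rows P53/L02a (for `Φ`), L02b, L02c (at THE
data), L02c', L02d. [cite: MochizukiFrdI2008, Prop. 5.3 p.103] -/
theorem rlfHypotheses_of (hΦ : PreFrobenioid.IsPerfFactorialOn Φ) (hM : IsMonoidOn Φ)
    (hrefl : PullbacksReflectDvd Φ) (hDc : IsGraphConnected D) (hDe : IsTotallyEpimorphic D)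
    (h02a : IsMonoidOnRlf Φ (PreFrobenioid.IsPerfFactorialOn.op hΦ))
    (h02b : RlfDivisorial Φ (PreFrobenioid.IsPerfFactorialOn.op hΦ))
    (h02c : IsMonoidOnRealSpan (RealificationData.canonical Φ (PreFrobenioid.IsPerfFactorialOn.op hΦ))
      (PreFrobenioid.biratSubfunctor F))
    (h02c' : RealSpanGroupLike (RealificationData.canonical Φ (PreFrobenioid.IsPerfFactorialOn.op hΦ))
      (PreFrobenioid.biratSubfunctor F))
    (h02d : BiratFSMSurjective F) : RlfHypotheses F hΦ where
  isMonoidOn := (id h02a : IsMonoidOn Φ → PullbacksReflectDvd Φ → _) hM hrefl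
  isDivisorial := h02b
  isMonoidOn_rat := (id h02c : _ → _ → _ → _) ((id h02a : IsMonoidOn Φ → PullbacksReflectDvd Φ → _) hM hrefl)
    (fun X => ((id h02b : Objectwise _ _) X).isPreDivisorial.isIntegral) h02d
  isGroupLike_rat := h02c'
  isGraphConnected := hDc
  isTotallyEpimorphic := hDe

/-- **P53/L02, conclusion: THE `C^rlf` IS a Frobenioid, of isotropic type** — Thm. 5.2 (ii) (tree:
`ModelFrobenioid.isFrobenioid`, `isOfIsotropicType`, seat abc-iut-found) at THE realified data, from (H).
PROVED. [cite: MochizukiFrdI2008, Prop. 5.3 p.103] -/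
theorem rlf_isFrobenioid_of_hypotheses (hΦ : PreFrobenioid.IsPerfFactorialOn Φ) (h : RlfHypotheses F hΦ) :
    PreFrobenioid.IsFrobenioid (PreFrobenioid.rlfToElem F hΦ) ∧
      PreFrobenioid.IsOfIsotropicType (PreFrobenioid.rlfToElem F hΦ) :=
  ⟨ModelFrobenioid.isFrobenioid h.isMonoidOn h.isDivisorial h.isMonoidOn_rat h.isGroupLike_rat
      h.isGraphConnected h.isTotallyEpimorphic,
    ModelFrobenioid.isOfIsotropicType h.isGroupLike_rat⟩

/-! ### Proposition 5.3: THE natural functor `C^istr → C^rlf` (vertical arrows of Cor. 5.4) -/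

/-- **P53/L05c**: THE natural functor `ι : C^istr → C^rlf` of Prop. 5.3 — the composite
`C^istr → C^un-tr ≌ (model of (Φ, Φ^birat)) → C^rlf` of the 1-commutative diagram (p. 103 ll. 20–30), at THE
constructions `toUntr` (Def. 3.1 (iv)) and `untrToRlf` (model description, seat abc-iut-L1-d2), PARAMETRISED
by the comparison equivalence `e : C^un-tr ≌ untrModel F` of `Prop53_untr` (Thm. 5.2 (iv) at `C^un-tr`, seat
abc-iut-L6-t8).  DATA (a functor), no claim. [cite: MochizukiFrdI2008, Prop. 5.3 p.103] -/
def iotaRlf (hΦ : PreFrobenioid.IsPerfFactorialOn Φ)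
    (e : (PreFrobenioidData.ofFunctor Φ F).Untr ≌ PreFrobenioid.untrModel F) :
    (PreFrobenioidData.ofFunctor Φ F).Istr ⥤ PreFrobenioid.rlf F hΦ :=
  (PreFrobenioidData.ofFunctor Φ F).toUntr ⋙ e.functor ⋙ PreFrobenioid.untrToRlf F hΦ

/-- **P53/L05c'**: `ι : C^istr → C^rlf` lies over `D` — its composite with the base projection of `C^rlf` is
(isomorphic to) `C^istr ⊆ C → D` — granted that the comparison equivalence `e` lies over `D`
("compatible with the functors to the respective elementary Frobenioids").
[cite: MochizukiFrdI2008, Prop. 5.3 p.103] -/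
def IotaRlfOverBase (hΦ : PreFrobenioid.IsPerfFactorialOn Φ)
    (e : (PreFrobenioidData.ofFunctor Φ F).Untr ≌ PreFrobenioid.untrModel F) : Prop :=
  Nonempty ((PreFrobenioidData.ofFunctor Φ F).toUntr ⋙ e.functor ⋙ ModelFrobenioid.baseFunctor _ _ _ ≅
      (PreFrobenioidData.ofFunctor Φ F).istrι ⋙ PreFrobenioid.baseFunctor F) →
    Nonempty (iotaRlf F hΦ e ⋙ ModelFrobenioid.baseFunctor _ _ _ ≅
      (PreFrobenioidData.ofFunctor Φ F).istrι ⋙ PreFrobenioid.baseFunctor F)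

end FrdI.Prop53Sub

/-! ### Corollary 5.4 in operations form over the data of Cor. 4.11 (iii)/(iv) -/

namespace FrdI.Cor54Sub

variable {D₁ : Type u₁'} [Category.{v₁'} D₁] {Φ₁ : D₁ᵒᵖ ⥤ CommMonCat.{w}}
  {C₁ : Type u₁} [Category.{v₁} C₁] (F₁ : C₁ ⥤ ElemFrobenioid Φ₁) (hΦ₁ : PreFrobenioid.IsPerfFactorialOn Φ₁)
  {D₂ : Type u₂'} [Category.{v₂'} D₂] {Φ₂ : D₂ᵒᵖ ⥤ CommMonCat.{w}}
  {C₂ : Type u₂} [Category.{v₂} C₂] (F₂ : C₂ ⥤ ElemFrobenioid Φ₂) (hΦ₂ : PreFrobenioid.IsPerfFactorialOn Φ₂)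

/-- The operations of THE realified Frobenioid `C^rlf → F_{Φ^rlf}` in seat abc-iut-L1-t3's packaging.
[cite: MochizukiFrdI2008, Prop. 5.3 p.103] -/
abbrev rlfData {D : Type u} [Category.{v} D] {Φ : Dᵒᵖ ⥤ CommMonCat.{w}} {C : Type u'} [Category.{v'} C]
    (F : C ⥤ ElemFrobenioid Φ) (hΦ : PreFrobenioid.IsPerfFactorialOn Φ) :
    PreFrobenioidData.{w} (PreFrobenioid.rlf F hΦ) D :=
  PreFrobenioidData.ofFunctor _ (PreFrobenioid.rlfToElem F hΦ)

/-- **C54/L02**: the isomorphism of divisor monoids `Ψ^Φ : Φ₁ ⥲ Φ₂` over `Ψ^Base` (Cor. 4.11 (iii), DATA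
`PreFrobenioidData.DivisorMonoidIsoOverBase`, a binder) REALIFIES: an isomorphism `Φ₁^rlf ⥲ Φ₂^rlf` over
`Ψ^Base`, natural with respect to pull-backs, lying over `Ψ^Φ` along `Φ_i → Φ_i^rlf` (functoriality of
`M ↦ M^rlf` in the monoid, `IsPerfFactorial.Rlf.map`). [cite: MochizukiFrdI2008, Cor. 5.4 p.104] -/
def RlfMonoidIso (ΨBase : D₁ ⥤ D₂) : Prop :=
  ∀ E : PreFrobenioidData.DivisorMonoidIsoOverBase
      (PreFrobenioidData.ofFunctor Φ₁ F₁) (PreFrobenioidData.ofFunctor Φ₂ F₂) ΨBase,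
    ∃ Erlf : PreFrobenioidData.DivisorMonoidIsoOverBase (rlfData F₁ hΦ₁) (rlfData F₂ hΦ₂) ΨBase,
      ∀ (X : D₁) (x : Φ₁.obj (op X)),
        Erlf.iso X (((toRlfNatTrans Φ₁ (PreFrobenioid.IsPerfFactorialOn.op hΦ₁)).app (op X)).hom x) =
          ((toRlfNatTrans Φ₂ (PreFrobenioid.IsPerfFactorialOn.op hΦ₂)).app (op (ΨBase.obj X))).hom
            (E.iso X x)

/-- **C54/L03** (INPUT-shaped row; content of Cor. 4.10 + Prop. 4.4 (iii) read through `biratSubfunctor`):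
`Ψ^Φ` carries the rational-function subfunctor `Φ₁^birat(X)` ONTO `Φ₂^birat(Ψ^Base X)`.
[cite: MochizukiFrdI2008, Cor. 5.4 p.104] -/
def BiratCompat (ΨBase : D₁ ⥤ D₂)
    (E : PreFrobenioidData.DivisorMonoidIsoOverBase
      (PreFrobenioidData.ofFunctor Φ₁ F₁) (PreFrobenioidData.ofFunctor Φ₂ F₂) ΨBase) : Prop :=
  ∀ X : D₁, ((PreFrobenioid.biratSubfunctor F₁).carrier X).map (MonGp.map (E.iso X).toMonoidHom) =
    (PreFrobenioid.biratSubfunctor F₂).carrier (ΨBase.obj X)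

/-- **C54/L04**: granted C54/L03, a realified `Ψ^Φ` (as in `RlfMonoidIso`) carries `ℝ · Φ₁^birat(X)` ONTO
`ℝ · Φ₂^birat(Ψ^Base X)` (THE spans; `ℝ`-linearity of `(f^rlf)^gp`, `IsPerfFactorial.Rlf.map_realSMul`).
[cite: MochizukiFrdI2008, Cor. 5.4 p.104] -/
def RealSpanCompat (ΨBase : D₁ ⥤ D₂)
    (E : PreFrobenioidData.DivisorMonoidIsoOverBase
      (PreFrobenioidData.ofFunctor Φ₁ F₁) (PreFrobenioidData.ofFunctor Φ₂ F₂) ΨBase)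
    (Erlf : PreFrobenioidData.DivisorMonoidIsoOverBase (rlfData F₁ hΦ₁) (rlfData F₂ hΦ₂) ΨBase) : Prop :=
  BiratCompat F₁ F₂ ΨBase E →
    (∀ (X : D₁) (x : Φ₁.obj (op X)),
        Erlf.iso X (((toRlfNatTrans Φ₁ (PreFrobenioid.IsPerfFactorialOn.op hΦ₁)).app (op X)).hom x) =
          ((toRlfNatTrans Φ₂ (PreFrobenioid.IsPerfFactorialOn.op hΦ₂)).app (op (ΨBase.obj X))).hom
            (E.iso X x)) →
      ∀ X : D₁,
        (((RealificationData.canonical Φ₁ (PreFrobenioid.IsPerfFactorialOn.op hΦ₁)).realSpan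
              (PreFrobenioid.biratSubfunctor F₁)).carrier X).map (MonGp.map (Erlf.iso X).toMonoidHom) =
          ((RealificationData.canonical Φ₂ (PreFrobenioid.IsPerfFactorialOn.op hΦ₂)).realSpan
              (PreFrobenioid.biratSubfunctor F₂)).carrier (ΨBase.obj X)

/-- **C54/L05**: the MODEL-LEVEL `Ψ^rlf`.  From an equivalence `Ψ^Base : D₁ ≌ D₂` and a realified `Ψ^Φ`
(`Erlf`) carrying the real spans onto each other, a functor `Ψ^rlf : C₁^rlf → C₂^rlf`
(`(A, α) ↦ (Ψ^Base A, (Ψ^Φ)^rlf α)` on objects) which is an EQUIVALENCE ("the horizontal arrows are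
equivalences of categories"), lies over `Ψ^Base` and carries divisors by `Erlf` and preserves Frobenius
degrees (operations form, as in `Cor411iv`).  Base-CHANGING analogue of `RealificationData.rlfModelMap`
(seat abc-iut-L1-d2, same base). [cite: MochizukiFrdI2008, Cor. 5.4 p.104] -/
def RlfTransport (ΨBase : D₁ ≌ D₂)
    (Erlf : PreFrobenioidData.DivisorMonoidIsoOverBase (rlfData F₁ hΦ₁) (rlfData F₂ hΦ₂) ΨBase.functor) :
    Prop :=
  (∀ X : D₁,
      (((RealificationData.canonical Φ₁ (PreFrobenioid.IsPerfFactorialOn.op hΦ₁)).realSpan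
            (PreFrobenioid.biratSubfunctor F₁)).carrier X).map (MonGp.map (Erlf.iso X).toMonoidHom) =
        ((RealificationData.canonical Φ₂ (PreFrobenioid.IsPerfFactorialOn.op hΦ₂)).realSpan
            (PreFrobenioid.biratSubfunctor F₂)).carrier (ΨBase.functor.obj X)) →
    ∃ (Ψrlf : PreFrobenioid.rlf F₁ hΦ₁ ⥤ PreFrobenioid.rlf F₂ hΦ₂)
      (η : Ψrlf ⋙ (rlfData F₂ hΦ₂).base ≅ (rlfData F₁ hΦ₁).base ⋙ ΨBase.functor),
      Ψrlf.IsEquivalence ∧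
        (∀ ⦃A B : PreFrobenioid.rlf F₁ hΦ₁⦄ (φ : A ⟶ B), (rlfData F₂ hΦ₂).degFr (Ψrlf.map φ) = (rlfData F₁ hΦ₁).degFr φ) ∧
        ∀ ⦃A B : PreFrobenioid.rlf F₁ hΦ₁⦄ (φ : A ⟶ B),
          (rlfData F₂ hΦ₂).div (Ψrlf.map φ) =
            (rlfData F₂ hΦ₂).pull (η.hom.app A) (Erlf.iso ((rlfData F₁ hΦ₁).base.obj A) ((rlfData F₁ hΦ₁).div φ))

/-! ### Corollary 5.4: the square, 1-uniqueness (honest form), rigidity, compatibility with Prop. 5.3 -/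

section Square

variable {F₁ F₂}
variable (Ψistr : (PreFrobenioidData.ofFunctor Φ₁ F₁).Istr ⥤ (PreFrobenioidData.ofFunctor Φ₂ F₂).Istr)
  (e₁ : (PreFrobenioidData.ofFunctor Φ₁ F₁).Untr ≌ PreFrobenioid.untrModel F₁)
  (e₂ : (PreFrobenioidData.ofFunctor Φ₂ F₂).Untr ≌ PreFrobenioid.untrModel F₂)
  (Ψrlf : PreFrobenioid.rlf F₁ hΦ₁ ⥤ PreFrobenioid.rlf F₂ hΦ₂)

/-- **C54/L06**: the 1-commutative square of Cor. 5.4 with THE vertical arrows `ι_i : C_i^istr → C_i^rlf` of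
Prop. 5.3 (`FrdI.Prop53Sub.iotaRlf`, parametrised by the comparison equivalences `e_i` of `Prop53_untr`) and
the restriction `Ψ^istr` of `Ψ` to the isotropic objects (Thm. 3.4 (i); a binder, as in `Cor411i`):
`ι₁ ⋙ Ψ^rlf ≅ Ψ^istr ⋙ ι₂`.  (Reduces to: `Ψ^un-tr` of Cor. 4.11 (i), read in the model descriptions through
`e₁`, `e₂`, followed by `untrToRlf`, is the data-induced functor — Cor. 4.11 (iv) for `C^un-tr`.)
[cite: MochizukiFrdI2008, Cor. 5.4 p.104] -/
def Square : Prop :=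
  Nonempty (FrdI.Prop53Sub.iotaRlf F₁ hΦ₁ e₁ ⋙ Ψrlf ≅ Ψistr ⋙ FrdI.Prop53Sub.iotaRlf F₂ hΦ₂ e₂)

/-- **C54/L08**: "Moreover, each of the composite functors of this diagram is rigid" (p. 104 l. 6–7; proof:
"by a similar argument applied to prove the rigidity assertion in Corollary 4.11, (i), (iv)", i.e. from the
Div-slimness of the `D_i`, which persists on the realified side since `Φ → Φ^rlf` is injective — seat
abc-iut-L1-d2's `isDivSlim_ofFunctor_rlf`).  Typed for the composites of the square of C54/L06 under the
Div-slimness of THE realified operations. [cite: MochizukiFrdI2008, Cor. 5.4 p.104] -/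
def Rigid : Prop :=
  (rlfData F₁ hΦ₁).IsDivSlim → (rlfData F₂ hΦ₂).IsDivSlim → Square hΦ₁ hΦ₂ Ψistr e₁ e₂ Ψrlf →
    IsRigidFunctor (FrdI.Prop53Sub.iotaRlf F₁ hΦ₁ e₁ ⋙ Ψrlf) ∧
      IsRigidFunctor (Ψistr ⋙ FrdI.Prop53Sub.iotaRlf F₂ hΦ₂ e₂)

/-- **C54/L09** (the final clause of Cor. 5.4, recorded-not-typed in `FrobenioidRealification.lean`, typed here
as a SCHEMA over named binders): "the formation of `Ψ^rlf` from `Ψ` is 1-compatible with the 1-commutative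
diagram of Proposition 5.3 [involving perfections, unit-trivializations, etc.]" — for ANY factorisations
`ι_i ≅ toPf_i ⋙ pfToRlf_i` of THE vertical arrows through categories `P_i` (the row `C^istr → C^pf →
(C^un-tr)^pf → C^rlf` of Prop. 5.3, THE `C_i^pf` of seat abc-iut-L1-d9 being the intended instance) and any
`Ψ^pf : P₁ → P₂` 1-commuting with the `toPf_i` (Thm. 3.4 (iii), `OneUniqueSquare`), the realified square
`pfToRlf₁ ⋙ Ψ^rlf ≅ Ψ^pf ⋙ pfToRlf₂` 1-commutes, granted that `toPf₁` is essentially surjective and full on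
isomorphisms up to which the square is tested (print: the diagram is 1-commutative as a whole).  Stated as the
bare compatibility of the two squares; the instance at THE perfections is the provers' slot.
[cite: MochizukiFrdI2008, Cor. 5.4 p.104] -/
def CompatProp53 {P₁ : Type*} [Category P₁] {P₂ : Type*} [Category P₂]
    (toPf₁ : (PreFrobenioidData.ofFunctor Φ₁ F₁).Istr ⥤ P₁) (pfToRlf₁ : P₁ ⥤ PreFrobenioid.rlf F₁ hΦ₁)
    (toPf₂ : (PreFrobenioidData.ofFunctor Φ₂ F₂).Istr ⥤ P₂) (pfToRlf₂ : P₂ ⥤ PreFrobenioid.rlf F₂ hΦ₂)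
    (Ψpf : P₁ ⥤ P₂) : Prop :=
  Nonempty (toPf₁ ⋙ pfToRlf₁ ≅ FrdI.Prop53Sub.iotaRlf F₁ hΦ₁ e₁) →
    Nonempty (toPf₂ ⋙ pfToRlf₂ ≅ FrdI.Prop53Sub.iotaRlf F₂ hΦ₂ e₂) →
      Nonempty (toPf₁ ⋙ Ψpf ≅ Ψistr ⋙ toPf₂) → Square hΦ₁ hΦ₂ Ψistr e₁ e₂ Ψrlf →
        Nonempty (toPf₁ ⋙ (pfToRlf₁ ⋙ Ψrlf) ≅ toPf₁ ⋙ (Ψpf ⋙ pfToRlf₂))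

end Square

/-- A functor `C₁^rlf → C₂^rlf` is INDUCED BY the data `(Ψ^Base, (Ψ^Φ)^rlf)` if it lies over `Ψ^Base`,
preserves Frobenius degrees and carries divisors by `(Ψ^Φ)^rlf` (the conclusions of `RlfTransport`).
[cite: MochizukiFrdI2008, Cor. 5.4 p.104] -/
def IsInducedBy (ΨBase : D₁ ⥤ D₂)
    (Erlf : PreFrobenioidData.DivisorMonoidIsoOverBase (rlfData F₁ hΦ₁) (rlfData F₂ hΦ₂) ΨBase)
    (Ψrlf : PreFrobenioid.rlf F₁ hΦ₁ ⥤ PreFrobenioid.rlf F₂ hΦ₂) : Prop :=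
  ∃ η : Ψrlf ⋙ (rlfData F₂ hΦ₂).base ≅ (rlfData F₁ hΦ₁).base ⋙ ΨBase,
    (∀ ⦃A B : PreFrobenioid.rlf F₁ hΦ₁⦄ (φ : A ⟶ B), (rlfData F₂ hΦ₂).degFr (Ψrlf.map φ) = (rlfData F₁ hΦ₁).degFr φ) ∧
      ∀ ⦃A B : PreFrobenioid.rlf F₁ hΦ₁⦄ (φ : A ⟶ B),
        (rlfData F₂ hΦ₂).div (Ψrlf.map φ) =
          (rlfData F₂ hΦ₂).pull (η.hom.app A) (Erlf.iso ((rlfData F₁ hΦ₁).base.obj A) ((rlfData F₁ hΦ₁).div φ))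

/-- **C54/L07** (1-uniqueness, HONEST FORM): "there exists a 1-unique functor `Ψ^rlf`" — print's proof
derives the uniqueness from the 1-uniqueness clauses of Cor. 4.10 / 4.11 (ii)(iii) (the inducing data
`Ψ^Base`, `Ψ^Φ` are determined by `Ψ`); typed here as: two functors `C₁^rlf → C₂^rlf` induced by the SAME
data `(Ψ^Base, (Ψ^Φ)^rlf)` are isomorphic.  NOTE (neutral, for the referee): the typed `PreFrobenioid.Cor54`
of `FrobenioidRealification.lean` quantifies its uniqueness clause over ALL functors fitting the square with
the (not essentially surjective) `ι_i : C_i → C_i^rlf`; that is a different (stronger-looking) rendering,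
neither asserted nor refuted here. [cite: MochizukiFrdI2008, Cor. 5.4 p.104] -/
def OneUniqueData (ΨBase : D₁ ⥤ D₂)
    (Erlf : PreFrobenioidData.DivisorMonoidIsoOverBase (rlfData F₁ hΦ₁) (rlfData F₂ hΦ₂) ΨBase) : Prop :=
  ∀ (Ψrlf Ψrlf' : PreFrobenioid.rlf F₁ hΦ₁ ⥤ PreFrobenioid.rlf F₂ hΦ₂),
    IsInducedBy F₁ hΦ₁ F₂ hΦ₂ ΨBase Erlf Ψrlf → IsInducedBy F₁ hΦ₁ F₂ hΦ₂ ΨBase Erlf Ψrlf' →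
      Nonempty (Ψrlf ≅ Ψrlf')

end FrdI.Cor54Sub

end Literature.AlgebraicGeometry.Frobenioids

end
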